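import Summits.BirchSwinnertonDyer.BirchSwinnertonDyer.Theorems.EisensteinPrimesCasselsTateDecision
import HarnessLib

/-!
# The Cassels–Tate decision road at a FLAT cell of analytic rank `≤ 1`: with `ord_p #Ш_an = 2` and the
# first-descent window `0 ≠ Ш[p]`, `#Ш[p] ∣ p²`, `BSD(E,p)` is EQUIVALENT to the one bit `Ш[p] ∩ pШ = 0`
# — Gross–Zagier–Kolyvagin and Cassels–Tate only (cell `bsd-eis`, seat `bsd-eis-k5-p4` g4, lens
# «Cassels–Tate / isogeny-descent decision road … decides each NOUNIT cell either way»; THEOREMS ONLY,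
# class-free; nothing booked, no label or count moves; helper on the A-rows of route `EisensteinPrimes`)

HONEST FRAMING (cell `bsd-eis`, run/shared/lean/pub/bsd-eis/). `EisensteinPrimesCasselsTateDecision.lean`
(g0) records the decision shapes at RANK `0`, where Wuthrich 2014 Prop. 21 supplies the upper half. This
file records the rank-`≤ 1` shape that needs NO upper-half theorem at all (no Kato / Wuthrich, no main
conjecture, no `p`-adic height, no Schneider): when `ord_p #Ш(E)_an = 2` and the two first `p`-isogeny
descents leave the window `Ш(E)[p] ≠ 0`, `#Ш(E)[p] ∣ p²`, the Cassels–Tate pairing (bsd.S18) already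
forces `#Ш(E)[p] = p²` (`card_sha_torsionBy_eq_sq_of_casselsTate`: the `p`-rank of a finite group with a
non-degenerate alternating `ℚ/ℤ`-valued pairing is even, tree theorem
`FiniteAbelian.exists_natCard_torsionBy_eq_pow_two_mul_of_circle`), and then

* (⇐) `Ш[p] ∩ pШ = 0` is stabilisation `Ш[p²] = Ш[p]`, so `ord_p #Ш = 2 = ord_p #Ш_an`: `BSD(E,p)` by
  `Typed.bsdp_of_stable` with Gross–Zagier–Kolyvagin (`hGZK`, bsd.S17) as the only named input
  (`bsdp_of_val_two_of_torsionBy_inf_range_eq_bot`);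
* (⇒) `BSD(E,p)` pins `ord_p #Ш = 2`, while `Ш[p] ∩ pШ ≠ 0` would force `p⁴ ∣ #Ш`
  (`pow_four_dvd_natCard_of_alternating_of_inf_ne_bot`, k5-c5 g3): so `Ш[p] ∩ pШ = 0`
  (`torsionBy_inf_range_eq_bot_of_bsdp_of_val_two`) — and the failing branch is QUANTIFIED:
  `¬ BSD(E,p) ↔ p⁴ ∣ #Ш(E)` (`not_bsdp_iff_pow_four_dvd_shaOrder_of_val_two`).

In the instrument's own currency the bit is ONE element and ONE trit (§2): a non-zero `a ∈ Ш(E)[p]` that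
is NOT a `p`-th multiple gives `BSD(E,p)` (`bsdp_of_val_two_of_exists_torsion_not_mem_range`: under the
window, `Ш[p] ∩ pШ` has cardinality an even power of `p` dividing `p²` — it is `0` or all of `Ш[p]`);
a non-zero `a ∈ Ш(E)[p] ∩ pШ(E)` refutes it (`not_bsdp_of_val_two_of_exists_torsion_mem_range`).

THE CELL THIS SERVES (evidence note on stmt-BirchSwinnertonDyer-19035; crux 6 `SchneiderOnX1TypeB`
territory class-wide). The one NOUNIT class of rows A1/A2/B11 (k5-p4 g3 «Cassels edge identity audit»,
79 969 `p`-isogeny edges: no other edge has `p ∣ #Ш_an` on both members): 371522j at `p = 3` (row A2,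
X1b type B, `r_an = 1`, `N = 2·431²`, class `{j1, j2}`, `#Ш_an = 9` on both, `S^{(φ)}(j1) ≅ ℤ/3 =
Ш(j1)[φ]`, `dim Ш(j2)[φ̂] = 1`, engines isogchi ‖ isogcft). There `0 → Ш(j1)[φ] → Ш(j1)[3] → Ш(j2)[φ̂]`
gives the window, and the deciding trit is the SECOND pairing of the `3`-isogeny tower — van Beek's
«further descent» pairing `S^{(φ)}(j1) × S^{(3)}(j1) → ℚ/ℤ` (PhD thesis, Cambridge 2015, Ch. 7,
eq. (7.1); right kernel `im S^{(3φ)}`), evaluated at `(a, d)` with `a` the generator of `S^{(φ)}(j1)` and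
`d` a lift of the `Ш`-class of `S^{(φ̂)}(j2)`: its left kernel is `Ш(j1)[φ] ∩ 3Ш(j1)`, so a NON-ZERO value
is exactly the hypothesis of `bsdp_of_val_two_of_exists_torsion_not_mem_range` and a ZERO value exactly
that of `not_bsdp_of_val_two_of_exists_torsion_mem_range` — equivalently `Sel^{(3)}(C_a/ℚ) = ∅`
resp. `≠ ∅` for the one plane cubic `C_a` (Creutz–Miller 2012 Lemma 2.3 with `φ = [3]`; Creutz 2014
second `3`-descent). The FIRST pairing of the tower (van Beek–Fisher 2018, the b2b engine `ctp3iso`)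
is identically zero on a `1`-dimensional isotropic `Ш[φ̂]` and a full `3`-descent reads
`dim S^{(3)} = 3` on both members whatever `Ш[3^∞]` is — neither decides this cell. No held engine
computes the trit; NOTHING is claimed about 371522j here.

What this is NOT: not a class theorem; not a certificate; not a statement that any instrument has read
the bit; `BSDp` is Miller's per-prime formula (`MissingPPartAt`), whose rank clause is GZK.

References: [Cassels1962ArithmeticIV] Thm. 1.1; [SilvermanAEC2009] Thm. X.4.2, X.4.14;
[MilneADT2006] Thm. I.6.13; [Miller2011LMS] §1, Def. 1.1; [CreutzMiller2012] Lemma 2.3; van Beek,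
*Computing the Cassels–Tate pairing*, PhD thesis, Cambridge 2015, doi:10.17863/CAM.16242, Ch. 7;
van Beek–Fisher, Acta Arith. 185 (2018) 367–396, §§1–2; Creutz, Math. Comp. (2014)
doi:10.1090/S0025-5718-2013-02713-5.
-/

set_option autoImplicit false
set_option linter.dupNamespace false

noncomputable section

open scoped Classical AddSubgroup

open WeierstrassCurve Literature.NumberTheory.EllipticCurves
  Literature.NumberTheory.EllipticCurves.ModularForms
  Literature.NumberTheory.EllipticCurves.Rank1Residual
  Literature.NumberTheory.EllipticCurves.Rank1Residual.Typed
  Literature.GroupTheory.FiniteAbelian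
  Summit.BirchSwinnertonDyer.BirchSwinnertonDyer.Theorems.EisensteinPrimesMazurMCOnX1RankZeroSecondDescentAlgebra
  Summit.BirchSwinnertonDyer.BirchSwinnertonDyer.Theorems.EisensteinPrimesMazurMCOnX1RankZeroSecondDescent

namespace Summit.BirchSwinnertonDyer.BirchSwinnertonDyer.Theorems.CasselsTateDecision

variable (W : WeierstrassCurve ℚ) [W.IsElliptic] (p : ℕ) [Fact p.Prime]

/-! ### §1 The flat-cell decision in analytic rank `≤ 1` (GZK + Cassels–Tate; no upper-half theorem) -/

section FlatCell

/-- **The first-descent window `Ш[p] ≠ 0`, `#Ш[p] ∣ p²` already gives `#Ш[p] = p²`** on a finite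
`Ш(E/ℚ)`: the `p`-rank of a finite abelian group carrying a non-degenerate alternating `ℚ/ℤ`-valued
pairing is EVEN (`FiniteAbelian.exists_natCard_torsionBy_eq_pow_two_mul_of_circle`), and the
Cassels–Tate pairing of `hCT` (bsd.S18) is such a pairing on a finite `Ш`
(`exists_nondegenerate_pairing_of_casselsTate`). Reading: two first `p`-isogeny descents with
`dim Ш(E)[φ] = 1 = dim Ш(E')[φ̂]` (so `p ∣ #Ш(E)[p] ∣ p²` from `0 → Ш(E)[φ] → Ш(E)[p] → Ш(E')[φ̂]`) pin
`dim_{𝔽_p} Ш(E)[p] = 2`. [cite: SilvermanAEC2009, Thm. X.4.14] [cite: MilneADT2006, Thm. I.6.13] -/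
theorem card_sha_torsionBy_eq_sq_of_casselsTate (hCT : exists_casselsTate_pairing (K := ℚ))
    (hfin : W.ShaFinite) (hne : W.sha[(p : ℤ)] ≠ ⊥) (hdvd : Nat.card (W.sha[(p : ℤ)]) ∣ p ^ 2) :
    Nat.card (W.sha[(p : ℤ)]) = p ^ 2 := by
  haveI : Finite W.sha := hfin
  have hp : p.Prime := Fact.out
  obtain ⟨B, halt, hnd⟩ := exists_nondegenerate_pairing_of_casselsTate W hCT hfin
  obtain ⟨k, hk⟩ := exists_natCard_torsionBy_eq_pow_two_mul_of_circle p W.sha B halt hnd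
  have hk0 : k ≠ 0 := by
    rintro rfl
    exact hne (AddSubgroup.eq_bot_of_card_eq _ (by simpa using hk))
  have hle : 2 * k ≤ 2 := by
    rw [hk] at hdvd
    exact (Nat.pow_dvd_pow_iff_le_right hp.one_lt).mp hdvd
  have hk1 : k = 1 := by omega
  rw [hk, hk1]

/-- **(⇐) `BSD(E,p)` from the bit, analytic rank `≤ 1`.** `ord_p #Ш(E)_an = 2` (`hq`, `hv`), the
first-descent window `Ш(E)[p] ≠ 0`, `#Ш(E)[p] ∣ p²` (`hne`, `hdvd`) and the bit `Ш(E)[p] ∩ pШ(E) = 0`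
(`hbot`) give `BSDp W p`: `#Ш[p] = p²` (`card_sha_torsionBy_eq_sq_of_casselsTate`), `Ш[p²] = Ш[p]`
(`sha_stable_one_of_torsionBy_inf_range_eq_bot`), hence `ord_p #Ш = 2 = ord_p #Ш_an`
(`Typed.bsdp_of_stable`). Named inputs: Gross–Zagier–Kolyvagin `hGZK` (bsd.S17: rank and finiteness)
and the Cassels–Tate pairing `hCT` (bsd.S18) — NO upper-half theorem, no main conjecture, no `p`-adic
height. Per curve; the three READ data are a finite computation; nothing is claimed about any curve.
[cite: SilvermanAEC2009, Thm. X.4.2 and X.4.14] [cite: Miller2011LMS, §1 and Def. 1.1] -/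
theorem bsdp_of_val_two_of_torsionBy_inf_range_eq_bot (hCT : exists_casselsTate_pairing (K := ℚ))
    (hGZK : rank_eq_analyticRank_of_analyticRank_le_one) (hr : W.analyticRank ≤ 1)
    (hne : W.sha[(p : ℤ)] ≠ ⊥) (hdvd : Nat.card (W.sha[(p : ℤ)]) ∣ p ^ 2)
    (hbot : W.sha[(p : ℤ)] ⊓ (nsmulAddMonoidHom (α := W.sha) p).range = ⊥)
    {q : ℚ} (hq : shaAn W = (q : ℂ)) (hv : padicValRat p q = 2) : BSDp W p := by
  have hfin : W.ShaFinite := (hGZK W hr).2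
  have hcard : Nat.card (AddSubgroup.torsionBy W.sha (p ^ 1 : ℕ)) = p ^ 2 := by
    rw [pow_one]
    exact card_sha_torsionBy_eq_sq_of_casselsTate W p hCT hfin hne hdvd
  exact bsdp_of_stable W p hGZK hr (sha_stable_one_of_torsionBy_inf_range_eq_bot W p hbot) hcard hq
    (by rw [hv]; norm_num)

/-- **(⇒) `BSD(E,p)` with `ord_p #Ш(E)_an = 2` forces the bit `Ш(E)[p] ∩ pШ(E) = 0`** (analytic rank
`≤ 1`; NO window hypothesis): `BSD(E,p)` pins `ord_p #Ш = 2`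
(`padicValRat_shaAn_eq_padicValNat_shaOrder_of_bsdp`), while `Ш[p] ∩ pШ ≠ 0` under the Cassels–Tate
pairing forces `p⁴ ∣ #Ш` (`pow_four_dvd_natCard_of_alternating_of_inf_ne_bot`).
[cite: SilvermanAEC2009, Thm. X.4.14] [cite: MilneADT2006, Thm. I.6.13] [cite: Miller2011LMS, Def. 1.1] -/
theorem torsionBy_inf_range_eq_bot_of_bsdp_of_val_two (hCT : exists_casselsTate_pairing (K := ℚ))
    (hGZK : rank_eq_analyticRank_of_analyticRank_le_one) (hr : W.analyticRank ≤ 1) (h : BSDp W p)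
    {q : ℚ} (hq : shaAn W = (q : ℂ)) (hv : padicValRat p q = 2) :
    W.sha[(p : ℤ)] ⊓ (nsmulAddMonoidHom (α := W.sha) p).range = ⊥ := by
  by_contra hR
  have hfin : W.ShaFinite := (hGZK W hr).2
  haveI : Finite W.sha := hfin
  obtain ⟨B, halt, hnd⟩ := exists_nondegenerate_pairing_of_casselsTate W hCT hfin
  have h4 : p ^ 4 ∣ W.shaOrder := by
    rw [WeierstrassCurve.shaOrder]
    exact pow_four_dvd_natCard_of_alternating_of_inf_ne_bot p B halt hnd hR
  have hval : (padicValNat p W.shaOrder : ℤ) = 2 :=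
    (padicValRat_shaAn_eq_padicValNat_shaOrder_of_bsdp W p hGZK hr h hq).symm.trans hv
  have h4' : 4 ≤ padicValNat p W.shaOrder :=
    (padicValNat_dvd_iff_le (WeierstrassCurve.shaOrder_pos W hfin).ne').mp h4
  omega

/-- **THE FLAT-CELL DECISION (analytic rank `≤ 1`): `ord_p #Ш(E)_an = 2`, `Ш(E)[p] ≠ 0`, `#Ш(E)[p] ∣ p²`
⇒ (`BSD(E,p)` ↔ `Ш(E)[p] ∩ pШ(E) = 0`).** Gross–Zagier–Kolyvagin + Cassels–Tate only. This is the
shape of the one NOUNIT class of rows A1/A2/B11, 371522j at `p = 3` (`r_an = 1`, `#Ш_an = 9` on both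
`3`-isogenous members, `dim Ш[φ] = 1 = dim Ш[φ̂]`): `BSD(371522j, 3)` holds iff the second Cassels–Tate
pairing of the `3`-isogeny tower is non-zero at its cell, and FAILS iff it vanishes — «either way». No
instrument has read that bit; nothing is claimed about the curve. [cite: SilvermanAEC2009, Thm. X.4.2 and X.4.14]
[cite: MilneADT2006, Thm. I.6.13] [cite: Miller2011LMS, §1 and Def. 1.1] -/
theorem bsdp_iff_torsionBy_inf_range_eq_bot_of_val_two (hCT : exists_casselsTate_pairing (K := ℚ))
    (hGZK : rank_eq_analyticRank_of_analyticRank_le_one) (hr : W.analyticRank ≤ 1)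
    (hne : W.sha[(p : ℤ)] ≠ ⊥) (hdvd : Nat.card (W.sha[(p : ℤ)]) ∣ p ^ 2)
    {q : ℚ} (hq : shaAn W = (q : ℂ)) (hv : padicValRat p q = 2) :
    BSDp W p ↔ W.sha[(p : ℤ)] ⊓ (nsmulAddMonoidHom (α := W.sha) p).range = ⊥ :=
  ⟨fun h ↦ torsionBy_inf_range_eq_bot_of_bsdp_of_val_two W p hCT hGZK hr h hq hv,
    fun hbot ↦ bsdp_of_val_two_of_torsionBy_inf_range_eq_bot W p hCT hGZK hr hne hdvd hbot hq hv⟩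

/-- **The failing branch, quantified: under the same data `¬ BSD(E,p) ↔ p⁴ ∣ #Ш(E)`** (analytic rank
`≤ 1`, `ord_p #Ш_an = 2`, window `Ш[p] ≠ 0`, `#Ш[p] ∣ p²`). (⇒) the decision and
`pow_four_dvd_natCard_of_alternating_of_inf_ne_bot`; (⇐) `p⁴ ∣ #Ш` makes `ord_p #Ш ≥ 4 ≠ 2`
(`pow_dvd_shaOrder_of_bsdp` read backwards). At 371522j@3: either `Ш ≅ (ℤ/3)²` on both members (BSD₃)
or `81 ∣ #Ш` on both (a counterexample) — the trit says which; none is claimed.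
[cite: SilvermanAEC2009, Thm. X.4.14] [cite: Miller2011LMS, §1 and Def. 1.1] -/
theorem not_bsdp_iff_pow_four_dvd_shaOrder_of_val_two (hCT : exists_casselsTate_pairing (K := ℚ))
    (hGZK : rank_eq_analyticRank_of_analyticRank_le_one) (hr : W.analyticRank ≤ 1)
    (hne : W.sha[(p : ℤ)] ≠ ⊥) (hdvd : Nat.card (W.sha[(p : ℤ)]) ∣ p ^ 2)
    {q : ℚ} (hq : shaAn W = (q : ℂ)) (hv : padicValRat p q = 2) :
    ¬ BSDp W p ↔ p ^ 4 ∣ W.shaOrder := by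
  have hfin : W.ShaFinite := (hGZK W hr).2
  haveI : Finite W.sha := hfin
  constructor
  · intro hn
    have hR : W.sha[(p : ℤ)] ⊓ (nsmulAddMonoidHom (α := W.sha) p).range ≠ ⊥ := fun hbot ↦
      hn (bsdp_of_val_two_of_torsionBy_inf_range_eq_bot W p hCT hGZK hr hne hdvd hbot hq hv)
    obtain ⟨B, halt, hnd⟩ := exists_nondegenerate_pairing_of_casselsTate W hCT hfin
    rw [WeierstrassCurve.shaOrder]
    exact pow_four_dvd_natCard_of_alternating_of_inf_ne_bot p B halt hnd hR
  · intro h4 h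
    have hval : (padicValNat p W.shaOrder : ℤ) = 2 :=
      (padicValRat_shaAn_eq_padicValNat_shaOrder_of_bsdp W p hGZK hr h hq).symm.trans hv
    have h4' : 4 ≤ padicValNat p W.shaOrder :=
      (padicValNat_dvd_iff_le (WeierstrassCurve.shaOrder_pos W hfin).ne').mp h4
    omega

end FlatCell

/-! ### §2 The bit in the instrument's currency: ONE `p`-torsion element of `Ш`, ONE trit -/

section Trit

/-- **Under the window, `Ш[p] ∩ pШ` is `0` or all of `Ш[p]`**: its cardinality is that of
`(Ш/Ш[p])[p]` (`FiniteAbelian.natCard_torsionBy_quot_eq`), an EVEN power of `p` because the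
Cassels–Tate pairing descends to a non-degenerate alternating pairing on `Ш/Ш[p]`
(`FiniteAbelian.exists_quotTorsionPairing`, `…exists_natCard_torsionBy_eq_pow_two_mul_of_circle`), and it
divides `#Ш[p] = p²`. So ONE element of `Ш(E)[p]` outside `pШ(E)` empties the intersection.
(Classically: `Ш[p^∞] ≅ (ℤ/p^k)²`, and `k = 1` iff some — equivalently every — non-zero `p`-torsion
element is not a `p`-th multiple.) [cite: SilvermanAEC2009, Thm. X.4.14] [cite: MilneADT2006, Thm. I.6.13] -/
theorem torsionBy_inf_range_eq_bot_of_exists_torsion_not_mem_range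
    (hCT : exists_casselsTate_pairing (K := ℚ)) (hfin : W.ShaFinite)
    (hdvd : Nat.card (W.sha[(p : ℤ)]) ∣ p ^ 2)
    (hwit : ∃ a : W.sha, p • a = 0 ∧ a ∉ (nsmulAddMonoidHom (α := W.sha) p).range) :
    W.sha[(p : ℤ)] ⊓ (nsmulAddMonoidHom (α := W.sha) p).range = ⊥ := by
  haveI : Finite W.sha := hfin
  have hp : p.Prime := Fact.out
  obtain ⟨a, hpa, hna⟩ := hwit
  have ha : a ∈ W.sha[(p : ℤ)] := AddSubgroup.torsionBy.nsmul_iff.mpr hpa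
  have hne : W.sha[(p : ℤ)] ≠ ⊥ := by
    intro hbot
    have : a = 0 := by rw [← AddSubgroup.mem_bot, ← hbot]; exact ha
    exact hna ⟨0, by rw [this, map_zero]⟩
  have hcard := card_sha_torsionBy_eq_sq_of_casselsTate W p hCT hfin hne hdvd
  obtain ⟨B, halt, hnd⟩ := exists_nondegenerate_pairing_of_casselsTate W hCT hfin
  obtain ⟨B', halt', hnd'⟩ := exists_quotTorsionPairing p B halt hnd
  obtain ⟨j, hj⟩ :=
    exists_natCard_torsionBy_eq_pow_two_mul_of_circle p (W.sha ⧸ W.sha[(p : ℤ)]) B' halt' hnd'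
  rw [natCard_torsionBy_quot_eq] at hj
  -- `#(Ш[p] ∩ pШ) = p^(2j)` divides `#Ш[p] = p²`, so `j ≤ 1`
  have hle : 2 * j ≤ 2 := by
    have h1 : Nat.card ↥(W.sha[(p : ℤ)] ⊓ (nsmulAddMonoidHom (α := W.sha) p).range) ∣
        Nat.card (W.sha[(p : ℤ)]) := AddSubgroup.card_dvd_of_le inf_le_left
    rw [hj, hcard] at h1
    exact (Nat.pow_dvd_pow_iff_le_right hp.one_lt).mp h1
  by_cases hj0 : j = 0
  · subst hj0
    exact AddSubgroup.eq_bot_of_card_eq _ (by simpa using hj)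
  · -- `j = 1`: the intersection is all of `Ш[p]`, so `a ∈ pШ` — contradiction
    exfalso
    have hj1 : j = 1 := by omega
    subst hj1
    have heq : W.sha[(p : ℤ)] ⊓ (nsmulAddMonoidHom (α := W.sha) p).range = W.sha[(p : ℤ)] :=
      AddSubgroup.eq_of_le_of_card_ge inf_le_left (by rw [hj, hcard])
    have : a ∈ W.sha[(p : ℤ)] ⊓ (nsmulAddMonoidHom (α := W.sha) p).range := by rw [heq]; exact ha
    exact hna (AddSubgroup.mem_inf.mp this).2

/-- **TRIT ≠ 0 ⇒ `BSD(E,p)`.** Analytic rank `≤ 1`, `ord_p #Ш(E)_an = 2`, window `#Ш(E)[p] ∣ p²`, and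
ONE element `a ∈ Ш(E)` with `p•a = 0` that is NOT a `p`-th multiple in `Ш(E)` ⇒ `BSDp W p`
(`torsionBy_inf_range_eq_bot_of_exists_torsion_not_mem_range` + §1). This is the reading of a NON-ZERO
value of the second Cassels–Tate pairing of a `p`-isogeny tower at `(a, ·)` — its left kernel on
`Ш(E)[φ]` is `Ш(E)[φ] ∩ pШ(E)` (van Beek 2015, Ch. 7, eq. (7.1)); equivalently of
`Sel^{(p)}(C_a/ℚ) = ∅` (Creutz–Miller 2012, Lemma 2.3 with `φ = [p]`). GZK + Cassels–Tate only; per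
curve; no instrument has produced such an `a` for any open cell; nothing is claimed about any curve.
[cite: CreutzMiller2012, Lemma 2.3] [cite: SilvermanAEC2009, Thm. X.4.2 and X.4.14]
[cite: Miller2011LMS, §1 and Def. 1.1] -/
theorem bsdp_of_val_two_of_exists_torsion_not_mem_range (hCT : exists_casselsTate_pairing (K := ℚ))
    (hGZK : rank_eq_analyticRank_of_analyticRank_le_one) (hr : W.analyticRank ≤ 1)
    (hdvd : Nat.card (W.sha[(p : ℤ)]) ∣ p ^ 2)
    (hwit : ∃ a : W.sha, p • a = 0 ∧ a ∉ (nsmulAddMonoidHom (α := W.sha) p).range)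
    {q : ℚ} (hq : shaAn W = (q : ℂ)) (hv : padicValRat p q = 2) : BSDp W p := by
  have hfin : W.ShaFinite := (hGZK W hr).2
  have hne : W.sha[(p : ℤ)] ≠ ⊥ := by
    obtain ⟨a, hpa, hna⟩ := hwit
    intro hbot
    have : a = 0 := by
      rw [← AddSubgroup.mem_bot, ← hbot]
      exact AddSubgroup.torsionBy.nsmul_iff.mpr hpa
    exact hna ⟨0, by rw [this, map_zero]⟩
  exact bsdp_of_val_two_of_torsionBy_inf_range_eq_bot W p hCT hGZK hr hne hdvd
    (torsionBy_inf_range_eq_bot_of_exists_torsion_not_mem_range W p hCT hfin hdvd hwit) hq hv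

/-- **TRIT = 0 ⇒ `¬ BSD(E,p)`.** Analytic rank `≤ 1`, `ord_p #Ш(E)_an = 2`, and ONE non-zero element
`a ∈ Ш(E)` with `p•a = 0` that IS a `p`-th multiple in `Ш(E)` ⇒ `BSD(E,p)` FAILS (then `p⁴ ∣ #Ш`):
`torsionBy_inf_range_eq_bot_of_bsdp_of_val_two` read backwards. This is the reading of a ZERO value of
the second Cassels–Tate pairing of the tower on the whole of `(a, S^{(p)}(E))`, equivalently of
`Sel^{(p)}(C_a/ℚ) ≠ ∅`. The counterexample shape of the flat cell; never observed; nothing claimed.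
[cite: CreutzMiller2012, Lemma 2.3] [cite: SilvermanAEC2009, Thm. X.4.14] [cite: Miller2011LMS, Def. 1.1] -/
theorem not_bsdp_of_val_two_of_exists_torsion_mem_range (hCT : exists_casselsTate_pairing (K := ℚ))
    (hGZK : rank_eq_analyticRank_of_analyticRank_le_one) (hr : W.analyticRank ≤ 1)
    (hdiv : ∃ a : W.sha, a ≠ 0 ∧ p • a = 0 ∧ a ∈ (nsmulAddMonoidHom (α := W.sha) p).range)
    {q : ℚ} (hq : shaAn W = (q : ℂ)) (hv : padicValRat p q = 2) : ¬ BSDp W p := by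
  intro h
  obtain ⟨a, ha0, hpa, hmem⟩ := hdiv
  have hbot := torsionBy_inf_range_eq_bot_of_bsdp_of_val_two W p hCT hGZK hr h hq hv
  apply ha0
  rw [← AddSubgroup.mem_bot, ← hbot, AddSubgroup.mem_inf]
  exact ⟨AddSubgroup.torsionBy.nsmul_iff.mpr hpa, hmem⟩

end Trit

end Summit.BirchSwinnertonDyer.BirchSwinnertonDyer.Theorems.CasselsTateDecision

end
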